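import Literature.AlgebraicGeometry.Motives.MixedHodgeStructureAbelianUniversal
import Literature.AlgebraicGeometry.Motives.MixedHodgeStructureHodgeNumbersAdditive
import Literature.AlgebraicGeometry.Motives.MixedHodgeStructureDualHodgeNumbers
import HarnessLib

/-!
# Duality exchanges kernels and cokernels of morphisms of mixed Hodge structures

For a morphism `f : H₁ → H₂` of mixed `ℚ`-Hodge structures on finite-dimensional spaces and its
transpose `f^∨ : H₂^∨ → H₁^∨` (`MixedHodgeStructure.Hom.transpose`, `Motives/MixedHodgeStructureDual.lean`),
the contravariant functor `H ↦ H^∨` of the abelian category of mixed Hodge structures (Deligne, *Hodge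
II*, Thm. 2.3.5; Cattani–El Zein–Griffiths–Lê, Thm. 3.2.18, Lemma 3.2.20 — "The statement on the
cokernel follows by duality" — and §3.2.2.7) is exact and exchanges kernels and cokernels:

* `Ker(f^∨) = (Im f)^⊥`, `Im(f^∨) = (Ker f)^⊥` (`ker_transpose_toSubmodule`, `range_transpose_toSubmodule`);
* `H₁ → H₂ → H₃` exact `⇒` `H₃^∨ → H₂^∨ → H₁^∨` exact (`Hom.exact_transpose`);
* **`(Coker f)^∨ ≅ Ker(f^∨)`** (`Hom.cokerDualHom`, bijective) and **`(Ker f)^∨ ≅ Coker(f^∨)`**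
  (`Hom.kerDualHom`, bijective), canonical morphisms of MHS built from the universal properties of the
  tree's `Hom.kerLift` / `Hom.cokerDesc` (`Motives/MixedHodgeStructureAbelianUniversal.lean`);
* Hodge numbers: `h^{p,q}(Ker f^∨) = h^{-p,-q}(Coker f)`, `h^{p,q}(Coker f^∨) = h^{-p,-q}(Ker f)`,
  `h^{p,q}(Im f^∨) = h^{-p,-q}(Im f)` (through `MixedHodgeStructure.hodgeNumber_dual`).

## References

* [CattaniElZeinGriffithsLe2014] E. Cattani et al. (eds.), *Hodge Theory* (2014), Thm. 3.2.18,
  Lemma 3.2.20 and its proof ("follows by duality"), §3.2.2.7 (the dual MHS).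
* [DeligneHodgeII1971] P. Deligne, Théorie de Hodge II, Thm. 2.3.5.
* [Fujiki1980] A. Fujiki, Duality of mixed Hodge structures of algebraic varieties, Publ. RIMS 16
  (1980), (1.6.2) a)–b).
-/

noncomputable section

namespace Literature.AlgebraicGeometry.Motives

namespace MixedHodgeStructure

namespace Hom

universe u v w

variable {V : Type u} [AddCommGroup V] [Module ℚ V] [FiniteDimensional ℚ V]
variable {V' : Type v} [AddCommGroup V'] [Module ℚ V'] [FiniteDimensional ℚ V']
variable {V'' : Type w} [AddCommGroup V''] [Module ℚ V''] [FiniteDimensional ℚ V'']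
variable {H₁ : MixedHodgeStructure V} {H₂ : MixedHodgeStructure V'} {H₃ : MixedHodgeStructure V''}

open Module

/-! ### Kernel and image of the transpose -/

/-- `0^∨ = 0`. [cite: CattaniElZeinGriffithsLe2014, §3.2.2.7] -/
@[simp]
theorem transpose_zero : (Hom.zero H₁ H₂).transpose = Hom.zero H₂.dual H₁.dual := by
  refine Hom.ext ?_
  rw [transpose_toLinearMap]
  change LinearMap.dualMap (0 : V →ₗ[ℚ] V') = 0
  exact map_zero (Module.Dual.transpose (R := ℚ))

/-- **`Ker(f^∨) = (Im f)^⊥`.** [cite: CattaniElZeinGriffithsLe2014, Lemma 3.2.20] -/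
theorem ker_transpose_toSubmodule (f : MixedHodgeStructure.Hom H₁ H₂) :
    f.transpose.ker.toSubmodule = (LinearMap.range f.toLinearMap).dualAnnihilator := by
  rw [ker_toSubmodule, transpose_toLinearMap, LinearMap.ker_dualMap_eq_dualAnnihilator_range]

/-- **`Im(f^∨) = (Ker f)^⊥`.** [cite: CattaniElZeinGriffithsLe2014, Lemma 3.2.20] -/
theorem range_transpose_toSubmodule (f : MixedHodgeStructure.Hom H₁ H₂) :
    f.transpose.range.toSubmodule = (LinearMap.ker f.toLinearMap).dualAnnihilator := by
  rw [range_toSubmodule, transpose_toLinearMap, LinearMap.range_dualMap_eq_dualAnnihilator_ker]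

/-- **The dual functor is exact**: if `H₁ →ᶠ H₂ →ᵍ H₃` is exact (`Im f = Ker g`) then so is
`H₃^∨ →^{g^∨} H₂^∨ →^{f^∨} H₁^∨` (`Ker f^∨ = (Im f)^⊥ = (Ker g)^⊥ = Im g^∨`).
[cite: CattaniElZeinGriffithsLe2014, Lemma 3.2.20] -/
theorem exact_transpose (f : MixedHodgeStructure.Hom H₁ H₂) (g : MixedHodgeStructure.Hom H₂ H₃)
    (hfg : Function.Exact f.toLinearMap g.toLinearMap) :
    Function.Exact g.transpose.toLinearMap f.transpose.toLinearMap := by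
  rw [LinearMap.exact_iff, transpose_toLinearMap, transpose_toLinearMap,
    LinearMap.ker_dualMap_eq_dualAnnihilator_range, LinearMap.range_dualMap_eq_dualAnnihilator_ker,
    hfg.linearMap_ker_eq]

/-! ### `(Coker f)^∨ ≅ Ker(f^∨)` -/

/-- `f^∨ ∘ (H₂ ↠ Coker f)^∨ = ((H₂ ↠ Coker f) ∘ f)^∨ = 0`. [cite: CattaniElZeinGriffithsLe2014, Lemma 3.2.20] -/
theorem transpose_comp_cokerMkQ_transpose (f : MixedHodgeStructure.Hom H₁ H₂) :
    f.transpose.comp f.cokerMkQ.transpose = Hom.zero f.coker.dual H₁.dual := by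
  rw [← transpose_comp, cokerMkQ_comp, transpose_zero]

/-- **The canonical morphism `(Coker f)^∨ → Ker(f^∨)`**: the transpose of the projection
`H₂ ↠ Coker f` lands in `Ker(f^∨)` (universal property of the kernel, `Hom.kerLift`).
[cite: CattaniElZeinGriffithsLe2014, Lemma 3.2.20] -/
def cokerDualHom (f : MixedHodgeStructure.Hom H₁ H₂) : Hom f.coker.dual f.transpose.ker.toMixedHodgeStructure :=
  f.transpose.kerLift f.cokerMkQ.transpose f.transpose_comp_cokerMkQ_transpose

/-- `(Ker f^∨ ↪ H₂^∨) ∘ cokerDualHom = (H₂ ↠ Coker f)^∨`. [cite: CattaniElZeinGriffithsLe2014, Lemma 3.2.20] -/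
theorem ker_subtype_comp_cokerDualHom (f : MixedHodgeStructure.Hom H₁ H₂) :
    f.transpose.ker.subtype.comp f.cokerDualHom = f.cokerMkQ.transpose :=
  ker_subtype_comp_kerLift _ _ _

/-- The underlying map of `cokerDualHom`, composed with the inclusion, is `φ ↦ φ ∘ (H₂ ↠ Coker f)`.
[cite: CattaniElZeinGriffithsLe2014, Lemma 3.2.20] -/
theorem coe_cokerDualHom_apply (f : MixedHodgeStructure.Hom H₁ H₂) (φ : Module.Dual ℚ (V' ⧸ LinearMap.range f.toLinearMap)) :
    (f.cokerDualHom.toLinearMap φ : Module.Dual ℚ V') = φ ∘ₗ (LinearMap.range f.toLinearMap).mkQ :=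
  congrArg (fun g : Hom f.coker.dual H₂.dual => g.toLinearMap φ) f.ker_subtype_comp_cokerDualHom

/-- **`(Coker f)^∨ ≅ Ker(f^∨)`**: `cokerDualHom` is bijective — injective because `(H₂ ↠ Coker f)^∨` is
(transpose of a surjection), surjective because `Ker(f^∨) = (Im f)^⊥ = Im((H₂ ↠ Coker f)^∨)`
(a form killing `Im f` descends to `Coker f`). With `Hom.inverse`, an isomorphism of MHS.
[cite: CattaniElZeinGriffithsLe2014, Lemma 3.2.20] -/
theorem cokerDualHom_bijective (f : MixedHodgeStructure.Hom H₁ H₂) :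
    Function.Bijective f.cokerDualHom.toLinearMap := by
  constructor
  · -- `subtype ∘ cokerDualHom = mkQ^∨` is injective
    have h : Function.Injective (f.transpose.ker.subtype.comp f.cokerDualHom).toLinearMap := by
      rw [ker_subtype_comp_cokerDualHom, transpose_toLinearMap]
      exact LinearMap.dualMap_injective_of_surjective (Submodule.mkQ_surjective _)
    rw [comp_toLinearMap, LinearMap.coe_comp] at h
    exact Function.Injective.of_comp h
  · rintro ⟨ψ, hψ⟩
    have hψ' : ψ ∈ LinearMap.range (LinearMap.range f.toLinearMap).mkQ.dualMap := by
      rw [Submodule.range_dualMap_mkQ_eq, ← LinearMap.ker_dualMap_eq_dualAnnihilator_range]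
      exact hψ
    obtain ⟨φ, rfl⟩ := hψ'
    refine ⟨φ, Subtype.ext ?_⟩
    rw [coe_cokerDualHom_apply]
    rfl

/-! ### `(Ker f)^∨ ≅ Coker(f^∨)` -/

/-- `(Ker f ↪ H₁)^∨ ∘ f^∨ = (f ∘ (Ker f ↪ H₁))^∨ = 0`. [cite: CattaniElZeinGriffithsLe2014, Lemma 3.2.20] -/
theorem ker_subtype_transpose_comp_transpose (f : MixedHodgeStructure.Hom H₁ H₂) :
    f.ker.subtype.transpose.comp f.transpose = Hom.zero H₂.dual f.ker.toMixedHodgeStructure.dual := by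
  rw [← transpose_comp, comp_ker_subtype, transpose_zero]

/-- **The canonical morphism `Coker(f^∨) → (Ker f)^∨`**: restriction of forms `H₁^∨ → (Ker f)^∨`
(the transpose of `Ker f ↪ H₁`) kills `Im(f^∨)`, so descends to `Coker(f^∨)` (universal property of
the cokernel, `Hom.cokerDesc`). [cite: CattaniElZeinGriffithsLe2014, Lemma 3.2.20] -/
def kerDualHom (f : MixedHodgeStructure.Hom H₁ H₂) : Hom f.transpose.coker f.ker.toMixedHodgeStructure.dual :=
  f.transpose.cokerDesc f.ker.subtype.transpose f.ker_subtype_transpose_comp_transpose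

/-- `kerDualHom ∘ (H₁^∨ ↠ Coker f^∨) = (Ker f ↪ H₁)^∨`. [cite: CattaniElZeinGriffithsLe2014, Lemma 3.2.20] -/
theorem kerDualHom_comp_cokerMkQ (f : MixedHodgeStructure.Hom H₁ H₂) :
    f.kerDualHom.comp f.transpose.cokerMkQ = f.ker.subtype.transpose :=
  cokerDesc_comp_cokerMkQ _ _ _

/-- `kerDualHom [φ] = φ|_{Ker f}`. [cite: CattaniElZeinGriffithsLe2014, Lemma 3.2.20] -/
theorem kerDualHom_apply_mk (f : MixedHodgeStructure.Hom H₁ H₂) (φ : Module.Dual ℚ V) :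
    f.kerDualHom.toLinearMap (Submodule.Quotient.mk φ) = φ ∘ₗ (LinearMap.ker f.toLinearMap).subtype :=
  congrArg (fun g : Hom H₁.dual f.ker.toMixedHodgeStructure.dual => g.toLinearMap φ) f.kerDualHom_comp_cokerMkQ

/-- **`Coker(f^∨) ≅ (Ker f)^∨`**: `kerDualHom` is bijective — surjective because restriction
`H₁^∨ → (Ker f)^∨` is (transpose of an injection), injective because its kernel `(Ker f)^⊥` is
`Im(f^∨)`. With `Hom.inverse`, an isomorphism of MHS. [cite: CattaniElZeinGriffithsLe2014, Lemma 3.2.20] -/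
theorem kerDualHom_bijective (f : MixedHodgeStructure.Hom H₁ H₂) :
    Function.Bijective f.kerDualHom.toLinearMap := by
  constructor
  · rw [← LinearMap.ker_eq_bot, eq_bot_iff]
    intro x hx
    induction x using Submodule.Quotient.induction_on with
    | _ φ =>
      rw [LinearMap.mem_ker, kerDualHom_apply_mk] at hx
      rw [Submodule.mem_bot, Submodule.Quotient.mk_eq_zero, ← range_toSubmodule, range_transpose_toSubmodule,
        Submodule.mem_dualAnnihilator]
      intro w hw
      exact LinearMap.congr_fun hx ⟨w, hw⟩
  · have h : Function.Surjective (f.kerDualHom.comp f.transpose.cokerMkQ).toLinearMap := by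
      rw [kerDualHom_comp_cokerMkQ, transpose_toLinearMap]
      exact LinearMap.dualMap_surjective_of_injective Subtype.val_injective
    rw [comp_toLinearMap, LinearMap.coe_comp] at h
    exact Function.Surjective.of_comp h

/-! ### Hodge numbers -/

/-- **`h^{p,q}(Ker f^∨) = h^{-p,-q}(Coker f)`.** [cite: CattaniElZeinGriffithsLe2014, Lemma 3.2.20] -/
theorem hodgeNumber_ker_transpose (f : MixedHodgeStructure.Hom H₁ H₂) (p q : ℤ) :
    f.transpose.ker.toMixedHodgeStructure.hodgeNumber p q = f.coker.hodgeNumber (-p) (-q) := by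
  rw [← f.cokerDualHom.hodgeNumber_eq_of_bijective f.cokerDualHom_bijective, hodgeNumber_dual]

/-- **`h^{p,q}(Coker f^∨) = h^{-p,-q}(Ker f)`.** [cite: CattaniElZeinGriffithsLe2014, Lemma 3.2.20] -/
theorem hodgeNumber_coker_transpose (f : MixedHodgeStructure.Hom H₁ H₂) (p q : ℤ) :
    f.transpose.coker.hodgeNumber p q = f.ker.toMixedHodgeStructure.hodgeNumber (-p) (-q) := by
  rw [f.kerDualHom.hodgeNumber_eq_of_bijective f.kerDualHom_bijective, hodgeNumber_dual]

/-- **`h^{p,q}(Im f^∨) = h^{-p,-q}(Im f)`** (`h(Im f^∨) = h(H₂^∨) - h(Ker f^∨) = h(H₂) - h(Coker f) = h(Im f)`,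
read at `(-p,-q)`). [cite: CattaniElZeinGriffithsLe2014, Lemma 3.2.20] -/
theorem hodgeNumber_range_transpose (f : MixedHodgeStructure.Hom H₁ H₂) (p q : ℤ) :
    f.transpose.range.toMixedHodgeStructure.hodgeNumber p q = f.range.toMixedHodgeStructure.hodgeNumber (-p) (-q) := by
  have h1 := f.transpose.hodgeNumber_source_eq p q
  have h2 := f.hodgeNumber_target_eq (-p) (-q)
  rw [hodgeNumber_ker_transpose, hodgeNumber_dual] at h1
  omega

end Hom

end MixedHodgeStructure

end Literature.AlgebraicGeometry.Motives

end
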